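import Literature.NumberTheory.EllipticCurves.IwasawaAlgebraMuAdditiveProofs
import Literature.NumberTheory.EllipticCurves.IwasawaAlgebraMuQuotientProofs
import Literature.NumberTheory.EllipticCurves.IwasawaAlgebraDivisibilityProofs
import Literature.NumberTheory.EllipticCurves.IwasawaAlgebraProofs
import Summits.BirchSwinnertonDyer.BirchSwinnertonDyer.Theorems.UniversalToricDescentAcDualMuZeroCriterion
import HarnessLib

/-!
# Route UniversalToricDescent — the Λ-ALGEBRA of the two-sided link `X_Gr ↔ X_{∅,0}` in `μ`-currency
# (Castella 2017, Appendix A, Lemmas A.2–A.4; Burungale–Castella–Kim 2021, Thm. 4.1), for ANY prime `p`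

Lead prover bsd-wall-utd-p1 g21 (`--supports stmt-BirchSwinnertonDyer-24737`, crux `TwinAlgMuZeroAtThree` R2):
support item **P1 (algebraic half)** of the crux-idea card `local-indivisibility-road` (thesis
`BetaRoadMultThree`) — «K2 (Howard-type divisibility `Ch(X_{Gr,tors}) ∣ Ch(𝔖/Λκ_∞)²`) ∧ K1 (`loc_𝔭 κ_∞ ∉ p·U_𝔭`)
⟹ `X_{∅,0}` torsion with `μ = 0`», every Poitou–Tate / Cassels–Tate input kept as an explicit exact-sequence
or `μ`-inequality hypothesis on abstract `Λ`-modules, every module-algebra step PROVED. The same skeleton serves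
the signed (`±`) variant on bucket C₀ (card `height-two-newton-signed-beta`): nothing refers to the local condition.

Dictionary with [Castella2017HeegnerBeilinsonFlach, App. A] (`Λ = Λ^ac`, `𝔖 = Sel(K, 𝐓^ac)`, `U = H¹_Gr(K_𝔭, 𝐓^ac)`,
`loc = loc_𝔭`, `C = coker(loc_𝔭)`, `X = X(K, 𝐀^ac) = X_{Gr,Gr}`, `X₁ = X_{∅,Gr}`, `X₃ = X_{Gr,0}`, `X₀ = X_{∅,0}`):
* (A.4) `0 → 𝔖/Λκ → U/Λ·loc κ → C → 0` (tautological): §2 `muInvariant_quotient_span_eq_add` —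
  `μ(U/Λ loc κ) = μ(𝔖/Λκ) + μ(C)`; `injective_of_isTorsion_quotient` — `loc` injective from «`𝔖` torsion-free,
  `𝔖/Λκ` torsion, `U` torsion-free, `loc κ ≠ 0`».
* (A.5) `0 → C → X_{∅,Gr} → X → 0` (global duality): §1 `muInvariant_torsion_le_of_shortExact` —
  `μ((X_{∅,Gr})_tors) ≤ μ(C) + μ(X_tors)` (left exactness of the torsion functor; PROVED).
* (A.6)–(A.7) `0 → C → X_{∅,0} → X_{Gr,0} → 0` (global duality), `length_P(X_{0,Gr}) = length_P((X_{∅,Gr})_tors)`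
  and `X_{Gr,0} ≅ X_{0,Gr}^ι` (Lemma 2.3 (2)(3) of loc. cit.) enter ONLY as the hypothesis `μ(X₃) ≤ μ((X₁)_tors)`.
* §3 `isTorsion_and_muInvariant_eq_zero_of_not_mem_smul` — K1's currency: `U ≅ Λ`, `u ∉ pU` ⟹ `U/Λu` torsion
  with `μ = 0` (the `μ`-form of L1 `…FreeRankOneIndivisible.freeRankOneIndivisible`, p720585).
* §4 ASSEMBLY: `isTorsion_and_muInvariant_le_twoSided` (`X₀` torsion, `μ(X₀) ≤ μ(X_tors) + 2·μ(C)`);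
  `muInvariant_le_two_mul_of_howard` (+ Howard's `μ(X_tors) ≤ 2·μ(𝔖/Λκ)` ⟹ `μ(X₀) ≤ 2·μ(U/Λ·loc κ)`);
  `isTorsion_and_exists_generator_twoSided` (+ K1 `loc κ ∉ pU`, `U ≅ Λ` ⟹ `X₀` torsion and
  `Ch_Λ(X₀)·R₀⟦T⟧ = (g)` with a norm-one coefficient — LITERALLY the conclusion shape of `TwinAlgMuZeroAtThree`).

THEOREMS ONLY (no definition, no named fact, no `sorry`); no `Theses` import; any prime `p`. NOT supplied here
(the ARITHMETIC half of P1, and K1/K2): the global-duality sequences (A.5)/(A.7), the duality/conjugation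
inequality, Howard's divisibility at `3 ∥ N′`, `(β)`. BSD is not advanced by this file; stmt-24737 stays open.

References: [Castella2017HeegnerBeilinsonFlach] J. Lond. Math. Soc. 96 (2017), App. A, Lemmas A.2–A.4 (arXiv:1509.02761
pp. 18–20); [BurungaleCastellaKim2021] Thm. 4.1 (arXiv:1908.09512 p. 9); [BurungaleSkinnerTianWan2024] Prop. 1.18;
[Howard2004HeegnerKolyvagin] Thm. B; [Washington1997] §13.2; [GreenbergLNM1716] §5.
-/

noncomputable section
open scoped Classical

-- `…BirchSwinnertonDyer.BirchSwinnertonDyer.Theorems…` is the problem's mandated namespace (D-0017).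
set_option linter.dupNamespace false
set_option autoImplicit false

namespace Summit.BirchSwinnertonDyer.BirchSwinnertonDyer.Theorems.UniversalToricDescentTwoSidedMuTransfer

open Literature.NumberTheory.EllipticCurves Literature.NumberTheory.EllipticCurves.IwasawaAlgebra
  Literature.NumberTheory.EllipticCurves.Module
  Summit.BirchSwinnertonDyer.BirchSwinnertonDyer.Theorems.UniversalToricDescentAcDualMuZero

variable {p : ℕ} [Fact p.Prime]

/-! ### §0 Generalities on `μ` over `Λ = ℤ_p⟦T⟧` -/

/-- **`μ` does not increase along an injection into a finitely generated torsion `Λ`-module**: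
`N ↪ M` ⟹ `μ(N) ≤ μ(M)` (local lengths at `(p)` are monotone along injections and finite for `M`).
[cite: GreenbergLNM1716, §5, Remark following Cor. 5.5] [cite: Washington1997, §13.2] -/
theorem muInvariant_le_of_injective {N M : Type*} [AddCommGroup N] [Module (IwasawaAlgebra p) N]
    [AddCommGroup M] [Module (IwasawaAlgebra p) M] [Module.Finite (IwasawaAlgebra p) M]
    (hMt : Module.IsTorsion (IwasawaAlgebra p) M)
    (f : N →ₗ[IwasawaAlgebra p] M) (hf : Function.Injective f) :
    muInvariant p N ≤ muInvariant p M := by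
  let 𝔭 : PrimeSpectrum (IwasawaAlgebra p) := ⟨augIdealP p, isPrime_augIdealP_holds p⟩
  have hMfin : lengthAt (IwasawaAlgebra p) M 𝔭 ≠ ⊤ := lengthAt_ne_top_of_isTorsion p _ hMt 𝔭 rfl
  rw [muInvariant_eq_toNat_lengthAt p N 𝔭 rfl, muInvariant_eq_toNat_lengthAt p M 𝔭 rfl]
  exact ENat.toNat_le_toNat (lengthAt_le_of_injective f hf 𝔭) hMfin

/-- **`μ` is invariant under `Λ`-linear isomorphisms** (no finiteness needed: both local lengths agree).
[folklore] -/
theorem muInvariant_eq_of_linearEquiv {N M : Type*} [AddCommGroup N] [Module (IwasawaAlgebra p) N]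
    [AddCommGroup M] [Module (IwasawaAlgebra p) M] (e : N ≃ₗ[IwasawaAlgebra p] M) :
    muInvariant p N = muInvariant p M := by
  let 𝔭 : PrimeSpectrum (IwasawaAlgebra p) := ⟨augIdealP p, isPrime_augIdealP_holds p⟩
  have h1 : lengthAt (IwasawaAlgebra p) N 𝔭 ≤ lengthAt (IwasawaAlgebra p) M 𝔭 :=
    lengthAt_le_of_injective e.toLinearMap e.injective 𝔭
  have h2 : lengthAt (IwasawaAlgebra p) M 𝔭 ≤ lengthAt (IwasawaAlgebra p) N 𝔭 :=
    lengthAt_le_of_surjective e.toLinearMap e.surjective 𝔭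
  rw [muInvariant_eq_toNat_lengthAt p N 𝔭 rfl, muInvariant_eq_toNat_lengthAt p M 𝔭 rfl,
    le_antisymm h1 h2]

/-- An extension of a torsion module by a torsion module is torsion: `0 → C → X₀ → X₃ → 0` exact (in the
middle) with `C`, `X₃` torsion ⟹ `X₀` torsion (over any commutative ring). [folklore] -/
theorem isTorsion_of_exact {R : Type*} [CommRing R] {C X₀ X₃ : Type*} [AddCommGroup C]
    [_root_.Module R C] [AddCommGroup X₀] [_root_.Module R X₀] [AddCommGroup X₃] [_root_.Module R X₃]
    (f : C →ₗ[R] X₀) (g : X₀ →ₗ[R] X₃) (hfg : Function.Exact f g)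
    (hC : Module.IsTorsion R C) (hX₃ : Module.IsTorsion R X₃) : Module.IsTorsion R X₀ := by
  intro x
  obtain ⟨a, ha⟩ := @hX₃ (g x)
  have hax : g ((a : R) • x) = 0 := by rw [map_smul, ← Submonoid.smul_def, ha]
  obtain ⟨c, hc⟩ := (hfg ((a : R) • x)).mp hax
  obtain ⟨b, hb⟩ := @hC c
  refine ⟨b * a, ?_⟩
  rw [Submonoid.smul_def, Submonoid.coe_mul, mul_smul, ← hc, ← map_smul, ← Submonoid.smul_def, hb,
    map_zero]

/-! ### §1 (A.5): the torsion functor on `0 → C → X₁ → X → 0` with torsion kernel -/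

section TorsionLeftExact

variable {C X₁ X : Type*} [AddCommGroup C] [Module (IwasawaAlgebra p) C]
  [AddCommGroup X₁] [Module (IwasawaAlgebra p) X₁] [AddCommGroup X] [Module (IwasawaAlgebra p) X]

/-- **(A.5) ⟹ (A.6)-inequality.** For a short exact sequence `0 → C → X₁ → X → 0` of `Λ`-modules with `C`
torsion and `X₁` finitely generated, `μ((X₁)_tors) ≤ μ(C) + μ(X_tors)`: `C` lands in `(X₁)_tors`, and
`(X₁)_tors / C` injects into `X_tors` (left exactness of the torsion functor), so additivity and
monotonicity of `μ` apply. (Castella takes torsion in (A.5) and gets the EQUALITY (A.6) from his Lemma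
2.3 (3); the inequality is all the `μ = 0` road needs.)
[cite: Castella2017HeegnerBeilinsonFlach, App. A, (A.5)–(A.6) (arXiv:1509.02761 p. 20)] [cite: GreenbergLNM1716, §5] -/
theorem muInvariant_torsion_le_of_shortExact [Module.Finite (IwasawaAlgebra p) X₁]
    (f : C →ₗ[IwasawaAlgebra p] X₁) (g : X₁ →ₗ[IwasawaAlgebra p] X)
    (hf : Function.Injective f) (hg : Function.Surjective g) (hfg : Function.Exact f g)
    (hC : Module.IsTorsion (IwasawaAlgebra p) C) :
    muInvariant p (Submodule.torsion (IwasawaAlgebra p) X₁) ≤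
      muInvariant p C + muInvariant p (Submodule.torsion (IwasawaAlgebra p) X) := by
  haveI : IsNoetherian (IwasawaAlgebra p) X₁ := isNoetherian_of_isNoetherianRing_of_finite _ _
  haveI : Module.Finite (IwasawaAlgebra p) X := Module.Finite.of_surjective g hg
  haveI : IsNoetherian (IwasawaAlgebra p) X := isNoetherian_of_isNoetherianRing_of_finite _ _
  haveI : Module.Finite (IwasawaAlgebra p) (Submodule.torsion (IwasawaAlgebra p) X₁) :=
    Module.Finite.iff_fg.mpr (IsNoetherian.noetherian _)
  haveI : Module.Finite (IwasawaAlgebra p) (Submodule.torsion (IwasawaAlgebra p) X) :=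
    Module.Finite.iff_fg.mpr (IsNoetherian.noetherian _)
  have hfT : ∀ c : C, f c ∈ Submodule.torsion (IwasawaAlgebra p) X₁ := fun c => by
    obtain ⟨a, ha⟩ := @hC c
    exact (Submodule.mem_torsion_iff _).mpr ⟨a, by rw [Submonoid.smul_def, ← map_smul,
      ← Submonoid.smul_def, ha, map_zero]⟩
  let f' : C →ₗ[IwasawaAlgebra p] Submodule.torsion (IwasawaAlgebra p) X₁ := f.codRestrict _ hfT
  have hf'val : ∀ c, ((f' c : Submodule.torsion (IwasawaAlgebra p) X₁) : X₁) = f c := fun _ => rfl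
  have hf' : Function.Injective f' := fun a b h => hf (by rw [← hf'val a, ← hf'val b, h])
  have hgT : ∀ x ∈ Submodule.torsion (IwasawaAlgebra p) X₁, g x ∈ Submodule.torsion (IwasawaAlgebra p) X :=
    fun x hx => by
    obtain ⟨a, ha⟩ := (Submodule.mem_torsion_iff x).mp hx
    exact (Submodule.mem_torsion_iff _).mpr ⟨a, by rw [Submonoid.smul_def, ← map_smul,
      ← Submonoid.smul_def, ha, map_zero]⟩
  let g' : Submodule.torsion (IwasawaAlgebra p) X₁ →ₗ[IwasawaAlgebra p]
      Submodule.torsion (IwasawaAlgebra p) X := g.restrict hgT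
  have hg'val : ∀ x, ((g' x : Submodule.torsion (IwasawaAlgebra p) X) : X) = g (x : X₁) := fun _ => rfl
  let g'' : Submodule.torsion (IwasawaAlgebra p) X₁ →ₗ[IwasawaAlgebra p] LinearMap.range g' :=
    g'.rangeRestrict
  have hg''val : ∀ x, ((g'' x : LinearMap.range g') : Submodule.torsion (IwasawaAlgebra p) X) = g' x :=
    fun _ => rfl
  have hg'' : Function.Surjective g'' := LinearMap.surjective_rangeRestrict g'
  have hexact : Function.Exact f' g'' := by
    intro x
    constructor
    · intro hx
      have hgx : g (x : X₁) = 0 := by rw [← hg'val, ← hg''val, hx]; rfl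
      obtain ⟨c, hc⟩ := (hfg (x : X₁)).mp hgx
      exact ⟨c, Subtype.ext (by rw [hf'val, hc])⟩
    · rintro ⟨c, rfl⟩
      refine Subtype.ext (Subtype.ext ?_)
      rw [hg''val, hg'val, hf'val, (hfg (f c)).mpr ⟨c, rfl⟩]
      rfl
  have hadd : muInvariant p (Submodule.torsion (IwasawaAlgebra p) X₁) =
      muInvariant p C + muInvariant p (LinearMap.range g') :=
    muInvariant_add_of_shortExact_holds p (Submodule.torsion (IwasawaAlgebra p) X₁)
      (Submodule.torsion_isTorsion (R := IwasawaAlgebra p) (M := X₁)) f' g'' hf' hg'' hexact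
  have hle : muInvariant p (LinearMap.range g') ≤ muInvariant p (Submodule.torsion (IwasawaAlgebra p) X) :=
    muInvariant_le_of_injective (Submodule.torsion_isTorsion (R := IwasawaAlgebra p) (M := X))
      (LinearMap.range g').subtype (LinearMap.range g').injective_subtype
  omega

end TorsionLeftExact

/-! ### §2 (A.4): `0 → 𝔖/Λκ → U/Λ·loc κ → coker(loc) → 0` -/

section TautologicalSequence

variable {S U : Type*} [AddCommGroup S] [Module (IwasawaAlgebra p) S]
  [AddCommGroup U] [Module (IwasawaAlgebra p) U]

/-- **Injectivity of `loc` on a rank-one torsion-free `𝔖`** (the step «`Sel_{0,Gr}(K,𝐓) = 0`» of Lemma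
A.3): if `𝔖` is torsion-free, `𝔖/Λκ` is torsion (`𝔖` has rank one, generated by `κ` up to torsion),
`U` is torsion-free and `loc κ ≠ 0`, then `loc : 𝔖 → U` is injective: `loc s = 0`, `a•s = b•κ` with
`a ≠ 0` ⟹ `b • loc κ = 0` ⟹ `b = 0` ⟹ `a • s = 0` ⟹ `s = 0`. (In Castella's proof `loc κ` non-torsion
comes from the reciprocity law; on the `(β)`-road it comes from `loc κ ∉ pU`.)
[cite: Castella2017HeegnerBeilinsonFlach, App. A, Lemma A.3, proof (arXiv:1509.02761 p. 19)] -/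
theorem injective_of_isTorsion_quotient [NoZeroSMulDivisors (IwasawaAlgebra p) S]
    [NoZeroSMulDivisors (IwasawaAlgebra p) U] (loc : S →ₗ[IwasawaAlgebra p] U) (κ : S)
    (hS1 : Module.IsTorsion (IwasawaAlgebra p) (S ⧸ Submodule.span (IwasawaAlgebra p) {κ}))
    (hκ : loc κ ≠ 0) : Function.Injective loc := by
  rw [← LinearMap.ker_eq_bot, Submodule.eq_bot_iff]
  intro s hs
  rw [LinearMap.mem_ker] at hs
  obtain ⟨a, ha⟩ := @hS1 (Submodule.Quotient.mk s)
  rw [Submonoid.smul_def, ← Submodule.Quotient.mk_smul, Submodule.Quotient.mk_eq_zero,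
    Submodule.mem_span_singleton] at ha
  obtain ⟨b, hb⟩ := ha
  have hb0 : b • loc κ = 0 := by rw [← map_smul, hb, map_smul, hs, smul_zero]
  have hb' : b = 0 := (smul_eq_zero.mp hb0).resolve_right hκ
  have has : (a : IwasawaAlgebra p) • s = 0 := by rw [← hb, hb', zero_smul]
  exact (smul_eq_zero.mp has).resolve_left (nonZeroDivisors.coe_ne_zero a)

/-- **(A.4) in `μ`-currency.** For an injective `loc : 𝔖 → U` and `κ ∈ 𝔖`, the tautological sequence
`0 → 𝔖/Λκ → U/Λ·loc κ → U/loc(𝔖) → 0` is exact, so if `U` is finitely generated and `U/Λ·loc κ` is torsion,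
`μ(U/Λ·loc κ) = μ(𝔖/Λκ) + μ(U/loc 𝔖)`.
[cite: Castella2017HeegnerBeilinsonFlach, App. A, (A.4) and the display following it (arXiv:1509.02761 p. 19)]
[cite: GreenbergLNM1716, §5 (additivity of `μ`)] -/
theorem muInvariant_quotient_span_eq_add [Module.Finite (IwasawaAlgebra p) U]
    (loc : S →ₗ[IwasawaAlgebra p] U) (hloc : Function.Injective loc) (κ : S)
    (hT : Module.IsTorsion (IwasawaAlgebra p) (U ⧸ Submodule.span (IwasawaAlgebra p) {loc κ})) :
    muInvariant p (U ⧸ Submodule.span (IwasawaAlgebra p) {loc κ}) =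
      muInvariant p (S ⧸ Submodule.span (IwasawaAlgebra p) {κ}) +
        muInvariant p (U ⧸ LinearMap.range loc) := by
  have hle₁ : Submodule.span (IwasawaAlgebra p) {κ} ≤
      (Submodule.span (IwasawaAlgebra p) {loc κ}).comap loc := by
    rw [Submodule.span_singleton_le_iff_mem, Submodule.mem_comap]
    exact Submodule.mem_span_singleton_self _
  have hle₂ : Submodule.span (IwasawaAlgebra p) {loc κ} ≤ (LinearMap.range loc).comap LinearMap.id := by
    rw [Submodule.comap_id, Submodule.span_singleton_le_iff_mem]
    exact ⟨κ, rfl⟩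
  let ι : (S ⧸ Submodule.span (IwasawaAlgebra p) {κ}) →ₗ[IwasawaAlgebra p]
      (U ⧸ Submodule.span (IwasawaAlgebra p) {loc κ}) := Submodule.mapQ _ _ loc hle₁
  let π : (U ⧸ Submodule.span (IwasawaAlgebra p) {loc κ}) →ₗ[IwasawaAlgebra p]
      (U ⧸ LinearMap.range loc) := Submodule.mapQ _ _ LinearMap.id hle₂
  have hι : Function.Injective ι := by
    rw [← LinearMap.ker_eq_bot, Submodule.eq_bot_iff]
    intro x hx
    induction x using Submodule.Quotient.induction_on with
    | H s =>
      rw [LinearMap.mem_ker, Submodule.mapQ_apply, Submodule.Quotient.mk_eq_zero,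
        Submodule.mem_span_singleton] at hx
      obtain ⟨a, ha⟩ := hx
      rw [Submodule.Quotient.mk_eq_zero, Submodule.mem_span_singleton]
      exact ⟨a, hloc (by rw [map_smul, ha])⟩
  have hπ : Function.Surjective π := by
    intro y
    induction y using Submodule.Quotient.induction_on with
    | H u => exact ⟨Submodule.Quotient.mk u, by rw [Submodule.mapQ_apply, LinearMap.id_apply]⟩
  have hιπ : Function.Exact ι π := by
    intro y
    induction y using Submodule.Quotient.induction_on with
    | H u =>
      constructor
      · intro hu
        rw [Submodule.mapQ_apply, LinearMap.id_apply, Submodule.Quotient.mk_eq_zero] at hu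
        obtain ⟨s, hs⟩ := hu
        exact ⟨Submodule.Quotient.mk s, by rw [Submodule.mapQ_apply, hs]⟩
      · rintro ⟨x, hx⟩
        induction x using Submodule.Quotient.induction_on with
        | H s =>
          rw [Submodule.mapQ_apply, Submodule.Quotient.eq, Submodule.mem_span_singleton] at hx
          obtain ⟨a, ha⟩ := hx
          rw [Submodule.mapQ_apply, LinearMap.id_apply, Submodule.Quotient.mk_eq_zero]
          refine ⟨s - a • κ, ?_⟩
          rw [map_sub, map_smul, ha, sub_sub_cancel]
  exact muInvariant_add_of_shortExact_holds p _ hT ι π hι hπ hιπ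

end TautologicalSequence

/-! ### §3 K1's currency: `U ≅ Λ`, `u ∉ pU` ⟹ `U/Λu` torsion with `μ = 0` -/

section RankOne

variable {U : Type*} [AddCommGroup U] [Module (IwasawaAlgebra p) U]

/-- **`U ≅ Λ` and `u ∉ p·U` ⟹ `U/Λu` is `Λ`-torsion with `μ(U/Λu) = 0`** (the `μ`-reading of L1: transport
to `Λ/(f)`, `f = e u ∉ (p)`, then `μ(Λ/(f)) = 0` by the tree's `muInvariant_quotient_span_eq_zero_of_not_mem`
and torsion because `f ≠ 0`). [cite: Washington1997, §13.2] [cite: GreenbergVatsal2000, p. 2, (1)–(2)] -/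
theorem isTorsion_and_muInvariant_eq_zero_of_not_mem_smul (e : U ≃ₗ[IwasawaAlgebra p] IwasawaAlgebra p)
    (u : U) (hu : ¬ ∃ v : U, u = (p : IwasawaAlgebra p) • v) :
    Module.IsTorsion (IwasawaAlgebra p) (U ⧸ Submodule.span (IwasawaAlgebra p) {u}) ∧
      muInvariant p (U ⧸ Submodule.span (IwasawaAlgebra p) {u}) = 0 := by
  set f : IwasawaAlgebra p := e u with hfdef
  have hf : f ∉ augIdealP p := by
    intro hmem
    rw [augIdealP, Ideal.mem_span_singleton] at hmem
    obtain ⟨g, hg⟩ := hmem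
    apply hu
    refine ⟨e.symm g, e.injective ?_⟩
    rw [LinearEquiv.map_smul, LinearEquiv.apply_symm_apply, smul_eq_mul, ← hfdef, hg,
      ← map_natCast (PowerSeries.C (R := ℤ_[p])) p]
  have hf0 : f ≠ 0 := fun h => hf (h ▸ Submodule.zero_mem _)
  have hmap : (Submodule.span (IwasawaAlgebra p) {u}).map (e : U →ₗ[IwasawaAlgebra p] IwasawaAlgebra p) =
      Ideal.span {f} := by
    rw [Submodule.map_span, Set.image_singleton]; rfl
  let e' : (U ⧸ Submodule.span (IwasawaAlgebra p) {u}) ≃ₗ[IwasawaAlgebra p]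
      (IwasawaAlgebra p ⧸ Ideal.span {f}) := Submodule.Quotient.equiv _ _ e hmap
  refine ⟨?_, ?_⟩
  · -- torsion: `f` kills `Λ/(f)`, transported back
    intro x
    refine ⟨⟨f, mem_nonZeroDivisors_of_ne_zero hf0⟩, ?_⟩
    apply e'.injective
    rw [Submonoid.mk_smul, LinearEquiv.map_smul, map_zero]
    generalize e' x = y
    induction y using Submodule.Quotient.induction_on with
    | H z =>
      rw [← Submodule.Quotient.mk_smul, Submodule.Quotient.mk_eq_zero, smul_eq_mul]
      exact Ideal.mul_mem_right _ _ (Ideal.mem_span_singleton_self f)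
  · rw [muInvariant_eq_of_linearEquiv e']
    exact muInvariant_quotient_span_eq_zero_of_not_mem hf

/-- `U ≅ Λ` ⟹ `U` is torsion-free (`Λ` is a domain). [folklore] -/
theorem noZeroSMulDivisors_of_linearEquiv (e : U ≃ₗ[IwasawaAlgebra p] IwasawaAlgebra p) :
    NoZeroSMulDivisors (IwasawaAlgebra p) U := by
  refine ⟨fun {a x} h => ?_⟩
  have h' : a • e x = 0 := by rw [← LinearEquiv.map_smul, h, map_zero]
  rcases smul_eq_zero.mp h' with ha | hx
  · exact Or.inl ha
  · exact Or.inr (e.injective (by rw [hx, map_zero]))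

end RankOne

/-! ### §4 Assembly: the two-sided link in `μ`-currency -/

section Assembly

variable {C X₁ X X₀ X₃ S U : Type*}
  [AddCommGroup C] [Module (IwasawaAlgebra p) C]
  [AddCommGroup X₁] [Module (IwasawaAlgebra p) X₁] [AddCommGroup X] [Module (IwasawaAlgebra p) X]
  [AddCommGroup X₀] [Module (IwasawaAlgebra p) X₀] [AddCommGroup X₃] [Module (IwasawaAlgebra p) X₃]
  [AddCommGroup S] [Module (IwasawaAlgebra p) S] [AddCommGroup U] [Module (IwasawaAlgebra p) U]
  [Module.Finite (IwasawaAlgebra p) X₁] [Module.Finite (IwasawaAlgebra p) X₀]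
  {f₁ : C →ₗ[IwasawaAlgebra p] X₁} {g₁ : X₁ →ₗ[IwasawaAlgebra p] X}
  (hf₁ : Function.Injective f₁) (hg₁ : Function.Surjective g₁) (h₁ : Function.Exact f₁ g₁)
  {f₀ : C →ₗ[IwasawaAlgebra p] X₀} {g₀ : X₀ →ₗ[IwasawaAlgebra p] X₃}
  (hf₀ : Function.Injective f₀) (hg₀ : Function.Surjective g₀) (h₀ : Function.Exact f₀ g₀)
  (hC : Module.IsTorsion (IwasawaAlgebra p) C) (hX₃ : Module.IsTorsion (IwasawaAlgebra p) X₃)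
  (hdual : muInvariant p X₃ ≤ muInvariant p (Submodule.torsion (IwasawaAlgebra p) X₁))

include hf₁ hg₁ h₁ hf₀ hg₀ h₀ hC hX₃ hdual

/-- **Two-sided link, `μ`-inequality form (Castella Lemmas A.2–A.4, algebra only).** Data: the global
duality sequences (A.5) `0 → C → X₁ → X → 0` and (A.7) `0 → C → X₀ → X₃ → 0` (short exact), `C` torsion,
`X₃` torsion, and the duality/conjugation input `μ(X₃) ≤ μ((X₁)_tors)` (Lemma 2.3 (2)(3) of loc. cit.).
Conclusion: `X₀` is `Λ`-torsion and `μ(X₀) ≤ μ(X_tors) + 2·μ(C)`.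
[cite: Castella2017HeegnerBeilinsonFlach, App. A, Lemma A.4 and its proof, (A.5)–(A.7) (arXiv:1509.02761 pp. 19–20)]
[cite: BurungaleCastellaKim2021, Thm. 4.1 (arXiv:1908.09512 p. 9)] -/
theorem isTorsion_and_muInvariant_le_twoSided :
    Module.IsTorsion (IwasawaAlgebra p) X₀ ∧
      muInvariant p X₀ ≤ muInvariant p (Submodule.torsion (IwasawaAlgebra p) X) + 2 * muInvariant p C := by
  have hX₀ : Module.IsTorsion (IwasawaAlgebra p) X₀ := isTorsion_of_exact f₀ g₀ h₀ hC hX₃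
  refine ⟨hX₀, ?_⟩
  have hA7 : muInvariant p X₀ = muInvariant p C + muInvariant p X₃ :=
    muInvariant_add_of_shortExact_holds p X₀ hX₀ f₀ g₀ hf₀ hg₀ h₀
  have hA6 := muInvariant_torsion_le_of_shortExact f₁ g₁ hf₁ hg₁ h₁ hC
  omega

/-- **Two-sided link + Howard's divisibility ⟹ `μ(X_{∅,0}) ≤ 2·μ(U/Λ·loc κ)`.** Further data: the class
`κ ∈ 𝔖`, the localisation `loc : 𝔖 → U` (injective), `C ≅ U/loc(𝔖)` (the cokernel in (A.4)/(A.5)), `U` finitely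
generated with `U/Λ·loc κ` torsion, and Howard's divisibility in `μ`-currency `μ(X_tors) ≤ 2·μ(𝔖/Λκ)` (from
`Ch(X_tors) ∣ Ch(𝔖/Λκ)²`). Then `μ(X₀) ≤ μ(X_tors) + 2μ(C) ≤ 2μ(𝔖/Λκ) + 2μ(U/loc 𝔖) = 2μ(U/Λ·loc κ)`.
[cite: Castella2017HeegnerBeilinsonFlach, App. A, Lemmas A.3–A.4, Thm. A.5 (arXiv:1509.02761 pp. 19–20)]
[cite: Howard2004HeegnerKolyvagin, Thm. B] -/
theorem muInvariant_le_two_mul_of_howard [Module.Finite (IwasawaAlgebra p) U]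
    (κ : S) (loc : S →ₗ[IwasawaAlgebra p] U) (hloc : Function.Injective loc)
    (eC : C ≃ₗ[IwasawaAlgebra p] (U ⧸ LinearMap.range loc))
    (hT : Module.IsTorsion (IwasawaAlgebra p) (U ⧸ Submodule.span (IwasawaAlgebra p) {loc κ}))
    (hHoward : muInvariant p (Submodule.torsion (IwasawaAlgebra p) X) ≤
      2 * muInvariant p (S ⧸ Submodule.span (IwasawaAlgebra p) {κ})) :
    Module.IsTorsion (IwasawaAlgebra p) X₀ ∧
      muInvariant p X₀ ≤ 2 * muInvariant p (U ⧸ Submodule.span (IwasawaAlgebra p) {loc κ}) := by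
  obtain ⟨hX₀, hle⟩ := isTorsion_and_muInvariant_le_twoSided hf₁ hg₁ h₁ hf₀ hg₀ h₀ hC hX₃ hdual
  refine ⟨hX₀, ?_⟩
  have hA4 := muInvariant_quotient_span_eq_add loc hloc κ hT
  have hCe := muInvariant_eq_of_linearEquiv eC
  omega

/-- **Two-sided link + Howard + `(β)` ⟹ the conclusion of `TwinAlgMuZeroAtThree` at `X₀ = X_{∅,0}`.**
As `muInvariant_le_two_mul_of_howard`, except that injectivity of `loc` and the torsion of `U/Λ·loc κ`
are DERIVED from: `𝔖` torsion-free with `𝔖/Λκ` torsion (rank one), `U ≅ Λ` (free of rank one), and K1 in its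
local form `loc κ ∉ p·U`. Then `X₀` is `Λ`-torsion and `Ch_Λ(X₀)·R₀⟦T⟧ = (g)` for some `g` with a coefficient
of `p`-adic norm `1` — algebraic `μ = 0` in the exact currency of the route's crux
`Summit.BirchSwinnertonDyer.BirchSwinnertonDyer.Theses.UniversalToricDescent.TwinAlgMuZeroAtThree`.
[cite: Castella2017HeegnerBeilinsonFlach, App. A, Lemmas A.2–A.4 (arXiv:1509.02761 pp. 18–20)]
[cite: BurungaleCastellaKim2021, Thm. 4.1] [cite: Howard2004HeegnerKolyvagin, Thm. B]
[cite: GreenbergVatsal2000, p. 2, (1)–(2)] -/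
theorem isTorsion_and_exists_generator_twoSided [NoZeroSMulDivisors (IwasawaAlgebra p) S]
    (κ : S) (hS1 : Module.IsTorsion (IwasawaAlgebra p) (S ⧸ Submodule.span (IwasawaAlgebra p) {κ}))
    (loc : S →ₗ[IwasawaAlgebra p] U) (eU : U ≃ₗ[IwasawaAlgebra p] IwasawaAlgebra p)
    (eC : C ≃ₗ[IwasawaAlgebra p] (U ⧸ LinearMap.range loc))
    (hHoward : muInvariant p (Submodule.torsion (IwasawaAlgebra p) X) ≤
      2 * muInvariant p (S ⧸ Submodule.span (IwasawaAlgebra p) {κ}))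
    (hβ : ¬ ∃ v : U, loc κ = (p : IwasawaAlgebra p) • v) :
    Module.IsTorsion (IwasawaAlgebra p) X₀ ∧
      ∃ g : UnrSeries p,
        (Module.charIdeal (IwasawaAlgebra p) X₀).map
            (PowerSeries.map (Summit.BirchSwinnertonDyer.Rank1Residual.X11b.Halves.toUnr p)) =
          Ideal.span {g} ∧
          ∃ i : ℕ, ‖((PowerSeries.coeff i g : unrIntegers p) : ℂ_[p])‖ = 1 := by
  haveI : NoZeroSMulDivisors (IwasawaAlgebra p) U := noZeroSMulDivisors_of_linearEquiv eU
  haveI : Module.Finite (IwasawaAlgebra p) U := Module.Finite.equiv eU.symm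
  have hloc := injective_of_isTorsion_quotient loc κ hS1 fun h => hβ ⟨0, by rw [h, smul_zero]⟩
  obtain ⟨hT, hμU⟩ := isTorsion_and_muInvariant_eq_zero_of_not_mem_smul eU (loc κ) hβ
  obtain ⟨hX₀, hle⟩ := muInvariant_le_two_mul_of_howard hf₁ hg₁ h₁ hf₀ hg₀ h₀ hC hX₃ hdual
    κ loc hloc eC hT hHoward
  have hμ : muInvariant p X₀ = 0 := by omega
  exact ⟨hX₀, exists_map_charIdeal_eq_span_of_muInvariant_eq_zero X₀ hX₀ hμ⟩

end Assembly

end Summit.BirchSwinnertonDyer.BirchSwinnertonDyer.Theorems.UniversalToricDescentTwoSidedMuTransfer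

end
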